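import Summits.HodgeConjecture.HodgeConjecture.Theses.DworkReflectionQuotients
import Literature.AlgebraicGeometry.HodgeTheory.DworkSexticReflectionTransfer
import Summits.HodgeConjecture.HodgeConjecture.Theorems.BoundaryReadoutPullbackAlgebraic

/-!
# Crux K1 `ReflectionQuotientDescent` of route `DworkReflectionQuotients`, modulo Bini–Garbagnati ONLY
# (Bredon's transfer discharged)

Route `route-HodgeConjecture-DworkReflectionQuotients` (cell `hodge-nonav`, rung F-H1 — never summit
credit), item `stmt-HodgeConjecture-20240`; landed `--supports stmt-HodgeConjecture-20240`. The tree's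
`reflectionQuotientDescent_of_facts` (`Theorems/DworkReflectionQuotientsK1ModuloFacts`) rested on TWO
named facts: Bredon's transfer `bredon1997_quotient_cohomology_invariants` and Bini–Garbagnati Prop. 3.20
`DworkSextic.BiniGarbagnati2012_reflectionQuotient_smoothProjective_rcc`. The first is now a THEOREM
for the reflection quotients of the Dwork pencil (`DworkSextic.reflTransfer`,
`Literature/AlgebraicGeometry/HodgeTheory/DworkSexticReflectionTransfer.lean`, via the proved semi-free
case of Bredon II.19.2, `Literature/AlgebraicTopology/SingularHomology/SemiFreeQuotientTransfer.lean`):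
this file records the crux as CONDITIONAL on Bini–Garbagnati alone (the reflection quotient
`X_ψ/⟨s⟩` is a smooth projective rationally chain connected fourfold — a published theorem together
with Kollár–Miyaoka–Mori). Fulton's pull-back shape is the tree theorem
`fulton1998_map_mem_algebraicClasses_holds`. Prover seat `hodge-nonav-20241-p1` (g7), 2026-08-27.
The item stays open until the Bini–Garbagnati fact is discharged.

## References

* G. Bini, A. Garbagnati, *Quotients of the Dwork pencil*, J. Geom. Phys. 75 (2014), Prop. 3.20.
  [BiniGarbagnati2012]
* G. E. Bredon, *Sheaf Theory*, 2nd ed., GTM 170 (1997), II.19.2. [Bredon1997]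
* S. Bloch, V. Srinivas, *Remarks on correspondences and algebraic cycles*, Amer. J. Math. 105
  (1983), Thm. 1 (3). [BlochSrinivas1983]
* W. Fulton, *Intersection Theory* (1998), §19.2. [Fulton1998]
-/

namespace Summit.HodgeConjecture.HodgeConjecture.Theorems

open Literature.AlgebraicGeometry.HodgeTheory Literature.AlgebraicTopology.SingularHomology

/-- **Crux K1 modulo Bini–Garbagnati only.** Granted the named fact
`DworkSextic.BiniGarbagnati2012_reflectionQuotient_smoothProjective_rcc`, the route statement
`ReflectionQuotientDescent` holds: for `ψ⁶ ≠ 1`, `i ≠ j`, `ζ⁶ = 1` and any continuous self-map `g` of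
`X_ψ(ℂ)` realising `s_(i,j,ζ)`, every rational `(2,2)`-class fixed by `g^*` is algebraic — it descends
to the quotient by the PROVED transfer (`DworkSextic.reflTransfer`), is algebraic there by
Bloch–Srinivas on the smooth rationally chain connected quotient, and pulls back algebraically by
`fulton1998_map_mem_algebraicClasses_holds`. One application of
`DworkSextic.mem_algebraicClasses_of_isRefl_invariant_of_BG`. CONDITIONAL on the one fact.
[cite: BiniGarbagnati2012, Prop. 3.20] [cite: BlochSrinivas1983, Thm. 1 (3)] -/
theorem reflectionQuotientDescent_of_BiniGarbagnati
    (h : DworkSextic.BiniGarbagnati2012_reflectionQuotient_smoothProjective_rcc) :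
    Summit.HodgeConjecture.HodgeConjecture.Theses.DworkReflectionQuotients.ReflectionQuotientDescent := by
  intro ψ hψ
  dsimp only
  intro i j hij ζ hζ g hg c hcr hct hc
  exact DworkSextic.mem_algebraicClasses_of_isRefl_invariant_of_BG hψ hij hζ h
    fulton1998_map_mem_algebraicClasses_holds hg hcr hct hc

end Summit.HodgeConjecture.HodgeConjecture.Theorems
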